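import Summits.NavierStokesRegularity.NavierStokesRegularity.Theorems.ExtremiserTransienceDepletedFractionCleanLockedWindow
import HarnessLib

/-!
# Crux `NearExtremalTransiencePerFlow` (stmt-NavierStokesRegularity-26567), LINES g13-α `budget_cut` / g13-β `relay`:
# W♭⁺ — ONE CLEAN LOCKED WINDOW AT THE TYPE-I SCALE (flow side, PROVED)

Theorems file (`--supports stmt-NavierStokesRegularity-26567`, helper; prover seat ns-net-p1 g17) landing the flank W♭⁺
`CleanLockedWindowAtScale` of the files-only skeletons
`Cruxes/NearExtremalTransiencePerFlow/Lines/budget_cut.lean` (ns-idea-5 g13, crux-write ae20d73eeec6, §1 :148 / proof §5 :292) and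
`Cruxes/NearExtremalTransiencePerFlow/Lines/relay.lean` (REV 2, crux-write 09c2e443f072, §1 :107 / proof §4 :400), with the statement
unfolded VERBATIM, so that a by-name `… : CleanLockedWindowAtScale := cleanLockedWindowAtScale_holds` closes it by `exact`.

Statement (W♭⁺).  The landed W♭ `CleanLockedWindow` (`DepletedFraction.cleanLockedWindow_holds`, p719836) with ONE extra conjunct
exporting the SCALE PIN `M = C√ν/√(T−τ)` of its window: a violator `u` of the crux (`IsViolator C ν T u p`) carries a coefficient
`k` with the strict-efficiency read-back, constants `Θ, G, H, c_w > 0`, and for every level `κ⋆/2 ≤ m < κ⋆`, every `η > 0` and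
every `0 < τ₁ ≤ c_w` ONE instant `τ` with the PINNED height bound `M = C√ν/√(T−τ)`, the Taylor lock `Z ≤ Θ(ν/M)²P`, the gradient
bound `G M²/ν`, heights `≤ H M` on `[τ, τ + τ₁ν/M²] ⊂ [0,T)`, whose forward window is `η`-CLEAN:
`|{k ≤ m} ∩ [τ, τ + τ₁ν/M²]| ≤ η·τ₁ν/M²`.  The pin makes `M` comparable to the true height by Leray's lower rate and `M·ν` the
violator's natural cell enstrophy; it is what the repaired heart `PinnedDepletedFraction` of g13-α/β quantifies over.

Proof.  The landed proof of `cleanLockedWindow_holds` (ns-net-p1 g15, p719836) VERBATIM — that proof DEFINES `M := C√ν/√(T−τ)` —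
with the single extra conjunct discharged by `rfl` (as in the workfiles, where it was kernel-checked rc 0 by the planner).
HONEST FRAMING: a statement about hypothetical Type-I singular flows violating the crux; nothing about Navier–Stokes regularity
or blow-up is proved; the hearts C♭ `CrowdDepletion` / D♭ `CellRelayDecomposition`, the junction `PinnedDepletedFraction`, ⟨26567⟩
and NS regularity remain OPEN; no summit is proved by a line. [folklore]
-/

noncomputable section

open scoped Topology InnerProductSpace RealInnerProductSpace ENNReal ContDiff
open MeasureTheory Filter Set Metric
open Literature.Analysis.FluidPDE
open Summit.NavierStokesRegularity.NavierStokesRegularity.Theorems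
open Summit.NavierStokesRegularity.NavierStokesRegularity.Theorems.DepletionLadder.KStar.HalfSpace
open Summit.NavierStokesRegularity.NavierStokesRegularity.Theorems.NearExtremalTransiencePerFlow.ZoneTransversality
open Summit.NavierStokesRegularity.NavierStokesRegularity.Theorems.NearExtremalTransiencePerFlow.DepletedFraction

namespace Summit.NavierStokesRegularity.NavierStokesRegularity.Theorems.NearExtremalTransiencePerFlow.PinnedDepletion

-- the summit's namespace repeats the problem name by convention (D-0017)
set_option linter.dupNamespace false

/-- **W♭⁺ `CleanLockedWindowAtScale` holds** (LINES g13-α `budget_cut` :148 / g13-β `relay` :107 on crux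
stmt-NavierStokesRegularity-26567, statement VERBATIM): a violator has, for every level `κ⋆/2 ≤ m < κ⋆`, every `η > 0` and every
`0 < τ₁ ≤ c_w`, one locked packaged instant `τ` with the PINNED height bound `M = C√ν/√(T−τ)` whose forward window
`[τ, τ + τ₁ν/M²]` is `η`-clean.  Proof = the landed proof of `DepletedFraction.cleanLockedWindow_holds` (p719836) verbatim, the pin
by `rfl`. [folklore] -/
theorem cleanLockedWindowAtScale_holds :
    ∀ (C ν T : ℝ) (u : ℝ → EuclideanSpace ℝ (Fin 3) → EuclideanSpace ℝ (Fin 3)) (p : ℝ → EuclideanSpace ℝ (Fin 3) → ℝ),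
    IsViolator C ν T u p →
    ∃ (k : ℝ → ℝ) (Θ G H c_w : ℝ),
      (∀ t ∈ Set.Ico 0 T, ∀ m : ℝ, 0 ≤ m → m < k t → ∃ M : ℝ, (∀ x, ‖u t x‖ ≤ M) ∧
        m * M * Real.sqrt (∫ x, ‖curl (u t) x‖ ^ 2) * Real.sqrt (∫ x, frobeniusNormSq (fderiv ℝ (curl (u t)) x)) <
          |∫ x, ⟪curl (u t) x, fderiv ℝ (u t) x (curl (u t) x)⟫_ℝ|) ∧
      0 < Θ ∧ 0 < G ∧ 0 < H ∧ 0 < c_w ∧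
      ∀ m : ℝ, kStar / 2 ≤ m → m < kStar → ∀ η : ℝ, 0 < η → ∀ τ₁ : ℝ, 0 < τ₁ → τ₁ ≤ c_w →
        ∃ τ M : ℝ, 0 ≤ τ ∧ 0 < M ∧ τ + τ₁ * ν / M ^ 2 < T ∧ M = C * Real.sqrt ν / Real.sqrt (T - τ) ∧ (∀ x, ‖u τ x‖ ≤ M) ∧
          (∫ x, ‖curl (u τ) x‖ ^ 2) ≤ Θ * (ν / M) ^ 2 * (∫ x, frobeniusNormSq (fderiv ℝ (curl (u τ)) x)) ∧
          (∀ x, ‖fderiv ℝ (u τ) x‖ ≤ G * M ^ 2 / ν) ∧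
          (∀ t' ∈ Set.Icc τ (τ + τ₁ * ν / M ^ 2), ∀ x, ‖u t' x‖ ≤ H * M) ∧
          volume ({σ : ℝ | k σ ≤ m} ∩ Set.Icc τ (τ + τ₁ * ν / M ^ 2)) ≤ ENNReal.ofReal (η * (τ₁ * ν / M ^ 2)) := by
  intro C ν T u p hV
  obtain ⟨hC, hν, hT, hsol, hLH, hdec, hrate, hsing, hno⟩ := hV
  have hsν : 0 < Real.sqrt ν := Real.sqrt_pos.2 hν
  have hC2 : 0 < C ^ 2 := by positivity
  -- the canonical coefficient: read-back and full upper log-density of efficient times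
  obtain ⟨k, hkm, hk01, hcl, hkle, hread, hdens⟩ :=
    DepletionLadder.PerFlow.efficientTimes_logDensity_of_not_perFlow hν hT hsol hLH hdec hno
  -- locked late times have lower log-density `d₀`
  obtain ⟨c₂, d₀, hd₀, hS⟩ := DepletionLadder.PerFlow.lockedTimes_logDensity hC hν hT hsol hLH hdec hrate hsing
  -- the Type-I onset and the gradient-rate onset
  obtain ⟨a₀, ha₀T, hsubI⟩ := mem_nhdsLT_iff_exists_Ioo_subset.1 hrate
  have ha₀T' : a₀ < T := ha₀T
  obtain ⟨C₁, hC₁, hgradev⟩ := DepletionLadder.PerFlow.gradTypeIRate_of_typeIRate hC hν hT hsol hLH hdec hrate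
  obtain ⟨a₁, ha₁T, hsubG⟩ := mem_nhdsLT_iff_exists_Ioo_subset.1 hgradev
  have ha₁T' : a₁ < T := ha₁T
  -- the onset `t₀ ∈ [0,T)`, strictly past both onsets
  set t₀ : ℝ := max 0 ((max a₀ a₁ + T) / 2) with ht₀def
  have hmaxT : max a₀ a₁ < T := max_lt ha₀T' ha₁T'
  have ht₀T : t₀ < T := max_lt hT (by linarith)
  have ht₀0 : 0 ≤ t₀ := le_max_left _ _
  have ha₀t₀ : a₀ < t₀ := lt_of_lt_of_le (by linarith [le_max_left a₀ a₁]) (le_max_right _ _)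
  have ha₁t₀ : a₁ < t₀ := lt_of_lt_of_le (by linarith [le_max_right a₀ a₁]) (le_max_right _ _)
  -- Type-I and gradient bounds past `t₀`
  have hTypeI : ∀ s : ℝ, t₀ ≤ s → s < T → ∀ x, ‖u s x‖ ≤ C * Real.sqrt ν / Real.sqrt (T - s) := by
    intro s h1 h2 x
    have hsq : 0 < Real.sqrt (T - s) := Real.sqrt_pos.2 (sub_pos.2 h2)
    rw [le_div_iff₀ hsq, mul_comm]
    exact hsubI ⟨ha₀t₀.trans_le h1, h2⟩ x
  have hGrad : ∀ s : ℝ, t₀ ≤ s → s < T → ∀ x, ‖fderiv ℝ (u s) x‖ ≤ C₁ / (T - s) := by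
    intro s h1 h2 x
    have hTs : 0 < T - s := sub_pos.2 h2
    rw [le_div_iff₀ hTs, mul_comm]
    exact hsubG ⟨ha₁t₀.trans_le h1, h2⟩ x
  -- the constants
  refine ⟨k, max c₂ 1 * C ^ 2, C₁ / C ^ 2, 2, C ^ 2 / 2, hread, by positivity, by positivity, by norm_num,
    by positivity, ?_⟩
  intro m hm_lo hm_lt η hη τ₁ hτ₁ hτ₁cw
  have hK : 0 < kStar := kStar_pos
  have hm0 : 0 ≤ m := by linarith
  -- the relative window length `a = τ₁/C² ∈ (0, 1/2]`
  set a : ℝ := τ₁ / C ^ 2 with hadef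
  have ha : 0 < a := div_pos hτ₁ hC2
  have ha2 : a ≤ 1 / 2 := by
    rw [hadef, div_le_iff₀ hC2]
    linarith
  have ha1 : a < 1 := by linarith
  -- the efficient / inefficient sets
  have hEm : MeasurableSet {s : ℝ | m < k s} := measurableSet_lt measurable_const hkm
  have hFm : MeasurableSet {σ : ℝ | k σ ≤ m} := measurableSet_le hkm measurable_const
  -- the locked set past `t₀`
  obtain ⟨S, hSmeas, hSsub, c, hSdens⟩ := hS t₀ ⟨ht₀0, ht₀T⟩
  -- the full-density instant `t`, with `δ = 1 − ηd₀/4`, `B = 1 + ηc/2`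
  have hmK : m < kStar := hm_lt
  unfold kStar udcSet at hmK
  have hδ : 1 - η * d₀ / 4 < 1 := by
    have : 0 < η * d₀ / 4 := by positivity
    linarith
  obtain ⟨t, ht, hEt⟩ := hdens m hmK (1 - η * d₀ / 4) hδ (1 + η * c / 2) t₀ ⟨ht₀0, ht₀T⟩
  have ht₀t : t₀ ≤ t := ht.1
  have htT : t < T := ht.2
  have hTt : 0 < T - t := sub_pos.2 htT
  have hlog0 : 0 ≤ Real.log ((T - t₀) / (T - t)) :=
    Real.log_nonneg ((one_le_div hTt).2 (by linarith))
  have hSt := hSdens t ht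
  -- `Λ(F) = ℓ − Λ(E)`
  have hFE : (fun τ => ({σ : ℝ | k σ ≤ m} : Set ℝ).indicator (fun _ => (1 : ℝ)) τ / (T - τ)) =
      fun τ => 1 / (T - τ) - ({s : ℝ | m < k s} : Set ℝ).indicator (fun _ => (1 : ℝ)) τ / (T - τ) := by
    funext τ
    by_cases h : m < k τ
    · have h1 : τ ∈ ({s : ℝ | m < k s} : Set ℝ) := h
      have h2 : τ ∉ ({σ : ℝ | k σ ≤ m} : Set ℝ) := fun h' => absurd h (not_lt.2 h')
      rw [indicator_of_mem h1, indicator_of_notMem h2]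
      ring
    · have h1 : τ ∉ ({s : ℝ | m < k s} : Set ℝ) := h
      have h2 : τ ∈ ({σ : ℝ | k σ ≤ m} : Set ℝ) := not_lt.1 h
      rw [indicator_of_notMem h1, indicator_of_mem h2]
      ring
  have hΛF : ∫ τ in t₀..t, ({σ : ℝ | k σ ≤ m} : Set ℝ).indicator (fun _ => (1 : ℝ)) τ / (T - τ) =
      Real.log ((T - t₀) / (T - t)) - ∫ τ in t₀..t, ({s : ℝ | m < k s} : Set ℝ).indicator (fun _ => (1 : ℝ)) τ / (T - τ) := by
    have hIone : IntervalIntegrable (fun τ => (1 : ℝ) / (T - τ)) volume t₀ t := by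
      refine intervalIntegral.intervalIntegrable_one_div (fun τ hτ => ?_) (continuousOn_const.sub continuousOn_id)
      rw [Set.uIcc_of_le ht₀t] at hτ
      exact (sub_pos.2 (lt_of_le_of_lt hτ.2 htT)).ne'
    rw [hFE, intervalIntegral.integral_sub hIone (DepletionLadder.PerFlow.intervalIntegrable_indicator_div hEm ht₀t htT),
      integral_one_div_sub_eq_log ht₀t htT]
  -- the Tonelli count gives a clean locked point in `S`
  have hbig : 2 * (∫ τ in t₀..t, ({σ : ℝ | k σ ≤ m} : Set ℝ).indicator (fun _ => (1 : ℝ)) τ / (T - τ)) + 2 <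
      η * (∫ τ in t₀..t, S.indicator (fun _ => (1 : ℝ)) τ / (T - τ)) := by
    rw [hΛF]
    have h1 : η * (d₀ * Real.log ((T - t₀) / (T - t)) - c) ≤
        η * ∫ τ in t₀..t, S.indicator (fun _ => (1 : ℝ)) τ / (T - τ) := mul_le_mul_of_nonneg_left hSt hη.le
    have h2 : 0 ≤ η * d₀ * Real.log ((T - t₀) / (T - t)) := by positivity
    nlinarith [h1, hEt, h2]
  obtain ⟨τ, hτS, hclean⟩ := exists_clean_point ht₀t htT hSmeas hFm ha ha2 hη hbig
  -- the package at `τ`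
  obtain ⟨hτI, hlockτ⟩ := hSsub hτS
  have hτ0 : 0 ≤ τ := ht₀0.trans hτI.1
  have ht₀τ : t₀ ≤ τ := hτI.1
  have hτT : τ < T := hτI.2
  have hTτ : 0 < T - τ := sub_pos.2 hτT
  have hsqT : 0 < Real.sqrt (T - τ) := Real.sqrt_pos.2 hTτ
  set M : ℝ := C * Real.sqrt ν / Real.sqrt (T - τ) with hMdef
  have hM : 0 < M := by positivity
  have hM2 : M ^ 2 = C ^ 2 * ν / (T - τ) := by
    rw [hMdef, div_pow, mul_pow, Real.sq_sqrt hν.le, Real.sq_sqrt hTτ.le]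
  have hwin : τ₁ * ν / M ^ 2 = a * (T - τ) := by
    rw [hM2, hadef]
    field_simp
  have hνM : (ν / M) ^ 2 = ν * (T - τ) / C ^ 2 := by
    rw [div_pow, hM2]
    field_simp
  refine ⟨τ, M, hτ0, hM, ?_, rfl, fun x => hTypeI τ ht₀τ hτT x, ?_, ?_, ?_, ?_⟩
  · -- the window ends before `T`
    rw [hwin]
    have ha' : a * (T - τ) ≤ 1 / 2 * (T - τ) := mul_le_mul_of_nonneg_right ha2 hTτ.le
    linarith only [ha', hTτ]
  · -- the Taylor lock `Z ≤ Θ (ν/M)² P`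
    have hP0 : 0 ≤ ∫ x, frobeniusNormSq (fderiv ℝ (curl (u τ)) x) := integral_nonneg fun x => frobeniusNormSq_nonneg _
    have hνT : 0 ≤ ν * (T - τ) := by positivity
    calc (∫ x, ‖curl (u τ) x‖ ^ 2) ≤ c₂ * (ν * (T - τ)) * (∫ x, frobeniusNormSq (fderiv ℝ (curl (u τ)) x)) := hlockτ
      _ ≤ max c₂ 1 * (ν * (T - τ)) * (∫ x, frobeniusNormSq (fderiv ℝ (curl (u τ)) x)) :=
          mul_le_mul_of_nonneg_right (mul_le_mul_of_nonneg_right (le_max_left _ _) hνT) hP0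
      _ = max c₂ 1 * C ^ 2 * (ν / M) ^ 2 * (∫ x, frobeniusNormSq (fderiv ℝ (curl (u τ)) x)) := by
          rw [hνM]
          field_simp
  · -- the gradient bound `‖∇u(τ)‖ ≤ G M²/ν`
    intro x
    have h := hGrad τ ht₀τ hτT x
    have e : C₁ / C ^ 2 * M ^ 2 / ν = C₁ / (T - τ) := by
      rw [hM2]
      field_simp
    rw [e]
    exact h
  · -- heights `≤ 2M` on the window
    intro t' ht' x
    rw [hwin] at ht'
    have ha' : a * (T - τ) ≤ 1 / 2 * (T - τ) := mul_le_mul_of_nonneg_right ha2 hTτ.le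
    have ht'2 : t' ≤ τ + a * (T - τ) := ht'.2
    have ht'T : t' < T := by linarith only [ha', ht'2, hTτ]
    have hTt' : 0 < T - t' := sub_pos.2 ht'T
    have h4 : T - τ ≤ 4 * (T - t') := by linarith only [ha', ht'2, hTτ]
    have hb := hTypeI t' (ht₀τ.trans ht'.1) ht'T x
    have hsq : Real.sqrt (T - τ) ≤ 2 * Real.sqrt (T - t') := by
      have h2 : Real.sqrt 4 = 2 := by
        rw [show (4 : ℝ) = 2 ^ 2 by norm_num, Real.sqrt_sq (by norm_num)]
      calc Real.sqrt (T - τ) ≤ Real.sqrt (4 * (T - t')) := Real.sqrt_le_sqrt h4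
        _ = 2 * Real.sqrt (T - t') := by rw [Real.sqrt_mul (by norm_num), h2]
    have hsq' : 0 < Real.sqrt (T - t') := Real.sqrt_pos.2 hTt'
    have key : C * Real.sqrt ν / Real.sqrt (T - t') ≤ 2 * M := by
      rw [hMdef, div_le_iff₀ hsq',
        show 2 * (C * Real.sqrt ν / Real.sqrt (T - τ)) * Real.sqrt (T - t') =
          C * Real.sqrt ν * (2 * Real.sqrt (T - t')) / Real.sqrt (T - τ) by ring,
        le_div_iff₀ hsqT]
      exact mul_le_mul_of_nonneg_left hsq (mul_pos hC hsν).le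
    exact hb.trans key
  · -- cleanliness
    rw [hwin]
    exact hclean

end Summit.NavierStokesRegularity.NavierStokesRegularity.Theorems.NearExtremalTransiencePerFlow.PinnedDepletion

end
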